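import Mathlib
import Summits.ValiantsHypothesis.ValiantsHypothesis.Theorems.GeneratorObstructionsGenFlipThesisChowDichotomy
import Literature.Computability.AlgebraicComplexity.StandardFamiliesProofs

/-!
# Route GeneratorObstructions — crux `GenFlipThesis` (stmt-ValiantsHypothesis-11653), line
# `slice-overflow`: the WEAKEST trace-side statement the overflow glue consumes (`slicePer`)

Helper file (`--supports stmt-ValiantsHypothesis-11653`; Edisonian repair census of the line).  The
line's composition `GenFlipThesis_of` (skeleton `Cruxes/GenFlipThesis/Lines/slice_overflow.lean`) uses
`stub_sliceGen` only at weights `ext_ι χ` where `χ` is ALREADY a generator type of `A(Δ per_m)`.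
Hence the crux follows from K1 = `PerGenDegreeSuperQP` and the weaker statement

  `slicePer`: for every `c` there is `c₀` such that for `1 ≤ m`, `m + e ≤ 2^((log₂ m + c)^c)`, the final
  segment `ι` and every `χ` with `γ_χ(per_m) ≠ 0`:  `γ_{ext_ι χ}(tr X_{m+e}^m) ≠ 0 → -|χ| ≤ m·2^((log₂ m + c₀)^c₀)`

(`genFlipThesis_of_perGenDegreeSuperQP_of_slicePer`, sorry-free, conclusion = the route decl by name;
`slicePer_of_sliceGen`: it is implied by the registered stub).  What the repair buys and what it does
not: `slicePer` is immune to late generators of qp-easy forms UNRELATED to the permanent (the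
determinant consequence `SliceDet.detGenQP_of_sliceGen` is no longer forced), but NOT to common
degenerations of `per_m` and `tr X^m`: late Chow generators still refute it
(`not_slicePer_of_chowLate`), because they are simultaneously generator types of `A(Δ per_m)`
(`ChowDichotomy.perGenDegreeSuperQP_of_chowLate`) and slice generator types of `A(Δ tr X_m^m)`.

Honest framing: implications between open statements; `GenFlipThesis`, K1, `stub_sliceGen`,
`slicePer` stay open; nothing here bears on `VP ≠ VNP`.
-/

namespace Summit.ValiantsHypothesis.ValiantsHypothesis.Theorems.GeneratorObstructions.SlicePer

open MvPolynomial
open Literature.NumberTheory.DiophantineGeometry Literature.Computability.AlgebraicComplexity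
  Literature.Barriers.ValiantsHypothesis
open Summit.ValiantsHypothesis.ValiantsHypothesis.Theses.GeneratorObstructions
open Summit.ValiantsHypothesis.ValiantsHypothesis.Theorems.GenInheritance
open Summit.ValiantsHypothesis.ValiantsHypothesis.Theorems.GeneratorObstructions.SliceTransfer
open Summit.ValiantsHypothesis.ValiantsHypothesis.Theorems.GeneratorObstructions.ChowDichotomy

-- `Summit.ValiantsHypothesis.ValiantsHypothesis.…` is the tree's mandated single-conjunct layout.
set_option linter.dupNamespace false

noncomputable section

/-- **Inheritance with the explicit final-segment weight, block placement** (the skeleton's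
`inheritFinal`, landed here): for `1 ≤ m`, a generator type `χ` of `A(Δ_m[per_m])` (own variables)
and ANY final segment `ι : MatIdx m → MatIdx (m+e)`, the weight `ext_ι χ` is a generator type of
`A(Δ_m[per_m on the top-left block])`.  `finrank_ne_zero_rename_of_strictMono` transported from the
final-segment placement to the block placement, which lie in one `GL_{(m+e)²}`-orbit
(`rename_mem_glOrbit_rename_of_injective`, `finrank_ne_zero_of_orbitVanishingIdeal_eq`). [folklore] -/
theorem inheritFinal (m e : ℕ) (hm : 1 ≤ m) {ι : MatIdx m → MatIdx (m + e)} (hι : StrictMono ι)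
    (hup : IsUpperSet (Set.range ι)) (χ : Weight (MatIdx m))
    (h : Module.finrank ℂ (↥(highestWeightSpace (orbitCoordRep (MvPolynomial.rename toLex (perPoly (Fin m) ℂ)) m) (χ)) ⧸ Submodule.comap (highestWeightSpace (orbitCoordRep (MvPolynomial.rename toLex (perPoly (Fin m) ℂ)) m) (χ)).subtype (⨆ p : Weight (MatIdx (m)) × Weight (MatIdx (m)), ⨆ (_ : p.1 + p.2 = (χ) ∧ p.1 ≠ 0 ∧ p.2 ≠ 0), highestWeightSpace (orbitCoordRep (MvPolynomial.rename toLex (perPoly (Fin m) ℂ)) m) p.1 * highestWeightSpace (orbitCoordRep (MvPolynomial.rename toLex (perPoly (Fin m) ℂ)) m) p.2)) ≠ 0) :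
    Module.finrank ℂ (↥(highestWeightSpace (orbitCoordRep (MvPolynomial.rename (fun ij : Fin m × Fin m => toLex (Fin.castAdd e ij.1, Fin.castAdd e ij.2)) (perPoly (Fin m) ℂ)) m) (Function.extend ι χ 0)) ⧸ Submodule.comap (highestWeightSpace (orbitCoordRep (MvPolynomial.rename (fun ij : Fin m × Fin m => toLex (Fin.castAdd e ij.1, Fin.castAdd e ij.2)) (perPoly (Fin m) ℂ)) m) (Function.extend ι χ 0)).subtype (⨆ p : Weight (MatIdx (m + e)) × Weight (MatIdx (m + e)), ⨆ (_ : p.1 + p.2 = (Function.extend ι χ 0) ∧ p.1 ≠ 0 ∧ p.2 ≠ 0), highestWeightSpace (orbitCoordRep (MvPolynomial.rename (fun ij : Fin m × Fin m => toLex (Fin.castAdd e ij.1, Fin.castAdd e ij.2)) (perPoly (Fin m) ℂ)) m) p.1 * highestWeightSpace (orbitCoordRep (MvPolynomial.rename (fun ij : Fin m × Fin m => toLex (Fin.castAdd e ij.1, Fin.castAdd e ij.2)) (perPoly (Fin m) ℂ)) m) p.2)) ≠ 0 := by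
  have hm0 : m ≠ 0 := by omega
  have hf : (rename toLex (perPoly (Fin m) ℂ) : MvPolynomial (MatIdx m) ℂ).IsHomogeneous m := by
    simpa using (perPoly_isHomogeneous (n := Fin m) (k := ℂ)).rename_isHomogeneous
      (f := (toLex : Fin m × Fin m → MatIdx m))
  have hf0 : (rename toLex (perPoly (Fin m) ℂ) : MvPolynomial (MatIdx m) ℂ) ≠ 0 :=
    (map_ne_zero_iff _ (rename_injective _ toLex.injective)).mpr (perPoly_ne_zero (Fin m) ℂ)
  have hκ : Function.Injective fun x : MatIdx m =>
      (toLex (Fin.castAdd e (ofLex x).1, Fin.castAdd e (ofLex x).2) : MatIdx (m + e)) := by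
    intro x y hxy
    have h1 := toLex.injective hxy
    rw [Prod.mk.injEq] at h1
    exact ofLex.injective (Prod.ext (Fin.castAdd_injective _ _ h1.1) (Fin.castAdd_injective _ _ h1.2))
  have key := finrank_ne_zero_of_orbitVanishingIdeal_eq
    (orbitVanishingIdeal_eq_of_mem_glOrbit
      (rename_mem_glOrbit_rename_of_injective _ ι hκ hι.injective
        (rename toLex (perPoly (Fin m) ℂ) : MvPolynomial (MatIdx m) ℂ)) m) hm0 _
    (finrank_ne_zero_rename_of_strictMono hι hup hf hf0 hm0 χ h)
  rw [rename_rename] at key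
  exact key

/-- **`GenFlipThesis` from K1 and `slicePer`** — the weakest trace-side statement the overflow glue
uses: a degree bound only at final-segment weights `ext_ι χ` whose `χ` is already a generator type
of `A(Δ per_m)`.  Same composition as the skeleton's `GenFlipThesis_of` (take `c₀` from `slicePer`
at `c`, `(m, χ)` from K1 at `c₀` beyond `max m₀ 1`, inherit along the final segment, overflow);
conclusion = the route decl by name. [folklore] -/
theorem genFlipThesis_of_perGenDegreeSuperQP_of_slicePer (hK1 : PerGenDegreeSuperQP)
    (hS : ∀ c : ℕ, ∃ c₀ : ℕ, ∀ m e : ℕ, 1 ≤ m → m + e ≤ 2 ^ ((Nat.log 2 m + c) ^ c) →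
      ∀ ι : MatIdx m → MatIdx (m + e), StrictMono ι → IsUpperSet (Set.range ι) →
        ∀ χ : Weight (MatIdx m),
          Module.finrank ℂ (↥(highestWeightSpace (orbitCoordRep (MvPolynomial.rename toLex (perPoly (Fin m) ℂ)) m) χ) ⧸ Submodule.comap (highestWeightSpace (orbitCoordRep (MvPolynomial.rename toLex (perPoly (Fin m) ℂ)) m) χ).subtype (⨆ p : Weight (MatIdx m) × Weight (MatIdx m), ⨆ (_ : p.1 + p.2 = χ ∧ p.1 ≠ 0 ∧ p.2 ≠ 0), highestWeightSpace (orbitCoordRep (MvPolynomial.rename toLex (perPoly (Fin m) ℂ)) m) p.1 * highestWeightSpace (orbitCoordRep (MvPolynomial.rename toLex (perPoly (Fin m) ℂ)) m) p.2)) ≠ 0 →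
          Module.finrank ℂ (↥(highestWeightSpace (orbitCoordRep (powFormLex ℂ (m + e) m) m) (Function.extend ι χ 0)) ⧸ Submodule.comap (highestWeightSpace (orbitCoordRep (powFormLex ℂ (m + e) m) m) (Function.extend ι χ 0)).subtype (⨆ p : Weight (MatIdx (m + e)) × Weight (MatIdx (m + e)), ⨆ (_ : p.1 + p.2 = (Function.extend ι χ 0) ∧ p.1 ≠ 0 ∧ p.2 ≠ 0), highestWeightSpace (orbitCoordRep (powFormLex ℂ (m + e) m) m) p.1 * highestWeightSpace (orbitCoordRep (powFormLex ℂ (m + e) m) m) p.2)) ≠ 0 →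
            -(Weight.size χ) ≤ (m : ℤ) * 2 ^ ((Nat.log 2 m + c₀) ^ c₀)) :
    GenFlipThesis := by
  intro c m₀
  obtain ⟨c₀, hc₀⟩ := hS c
  obtain ⟨m, hm, χ, hγ, hdeg⟩ := hK1 c₀ (max m₀ 1)
  have hm₀ : m₀ ≤ m := le_trans (le_max_left _ _) hm
  have h1m : 1 ≤ m := le_trans (le_max_right _ _) hm
  refine ⟨m, hm₀, h1m, fun e he => ?_⟩
  obtain ⟨ι, hι, hup⟩ := exists_finalSegment (n := m) (n' := m + e) (Nat.le_add_right m e)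
  have hγ' := inheritFinal m e h1m hι hup χ hγ
  refine ⟨Function.extend ι χ 0, lt_of_not_ge fun hle => ?_⟩
  have hne := (Nat.lt_of_lt_of_le (Nat.pos_of_ne_zero hγ') hle).ne'
  have hb := hc₀ m e h1m he ι hι hup χ hγ hne
  exact absurd (lt_of_lt_of_le hdeg hb) (lt_irrefl _)

/-- `stub_sliceGen ⇒ slicePer` (drop the hypothesis `γ_χ(per_m) ≠ 0`). [folklore] -/
theorem slicePer_of_sliceGen
    (hS : ∀ c : ℕ, ∃ c₀ : ℕ, ∀ m e : ℕ, 1 ≤ m → m + e ≤ 2 ^ ((Nat.log 2 m + c) ^ c) →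
      ∀ ι : MatIdx m → MatIdx (m + e), StrictMono ι → IsUpperSet (Set.range ι) →
        ∀ χ : Weight (MatIdx m),
          Module.finrank ℂ (↥(highestWeightSpace (orbitCoordRep (powFormLex ℂ (m + e) m) m) (Function.extend ι χ 0)) ⧸ Submodule.comap (highestWeightSpace (orbitCoordRep (powFormLex ℂ (m + e) m) m) (Function.extend ι χ 0)).subtype (⨆ p : Weight (MatIdx (m + e)) × Weight (MatIdx (m + e)), ⨆ (_ : p.1 + p.2 = (Function.extend ι χ 0) ∧ p.1 ≠ 0 ∧ p.2 ≠ 0), highestWeightSpace (orbitCoordRep (powFormLex ℂ (m + e) m) m) p.1 * highestWeightSpace (orbitCoordRep (powFormLex ℂ (m + e) m) m) p.2)) ≠ 0 →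
            -(Weight.size χ) ≤ (m : ℤ) * 2 ^ ((Nat.log 2 m + c₀) ^ c₀)) :
    ∀ c : ℕ, ∃ c₀ : ℕ, ∀ m e : ℕ, 1 ≤ m → m + e ≤ 2 ^ ((Nat.log 2 m + c) ^ c) →
      ∀ ι : MatIdx m → MatIdx (m + e), StrictMono ι → IsUpperSet (Set.range ι) →
        ∀ χ : Weight (MatIdx m),
          Module.finrank ℂ (↥(highestWeightSpace (orbitCoordRep (MvPolynomial.rename toLex (perPoly (Fin m) ℂ)) m) χ) ⧸ Submodule.comap (highestWeightSpace (orbitCoordRep (MvPolynomial.rename toLex (perPoly (Fin m) ℂ)) m) χ).subtype (⨆ p : Weight (MatIdx m) × Weight (MatIdx m), ⨆ (_ : p.1 + p.2 = χ ∧ p.1 ≠ 0 ∧ p.2 ≠ 0), highestWeightSpace (orbitCoordRep (MvPolynomial.rename toLex (perPoly (Fin m) ℂ)) m) p.1 * highestWeightSpace (orbitCoordRep (MvPolynomial.rename toLex (perPoly (Fin m) ℂ)) m) p.2)) ≠ 0 →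
          Module.finrank ℂ (↥(highestWeightSpace (orbitCoordRep (powFormLex ℂ (m + e) m) m) (Function.extend ι χ 0)) ⧸ Submodule.comap (highestWeightSpace (orbitCoordRep (powFormLex ℂ (m + e) m) m) (Function.extend ι χ 0)).subtype (⨆ p : Weight (MatIdx (m + e)) × Weight (MatIdx (m + e)), ⨆ (_ : p.1 + p.2 = (Function.extend ι χ 0) ∧ p.1 ≠ 0 ∧ p.2 ≠ 0), highestWeightSpace (orbitCoordRep (powFormLex ℂ (m + e) m) m) p.1 * highestWeightSpace (orbitCoordRep (powFormLex ℂ (m + e) m) m) p.2)) ≠ 0 →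
            -(Weight.size χ) ≤ (m : ℤ) * 2 ^ ((Nat.log 2 m + c₀) ^ c₀) := by
  intro c
  obtain ⟨c₀, hc₀⟩ := hS c
  exact ⟨c₀, fun m e hm he ι hι hup χ _ hγ => hc₀ m e hm he ι hι hup χ hγ⟩

/-- **Late Chow generators refute even `slicePer`**: a late generator type `χ` of the covariant
algebra of `Δ(x₁₁⋯x_mm)` is a generator type of `A(Δ per_m)` (`x₁₁⋯x_mm ∈ Δ(per_m)`,
`prod_X_diag_mem_orbitClosure_perPoly`) AND, placed on the final segment, of `A(Δ tr X_m^m)`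
(`prod_X_mem_orbitClosure_powFormLex`, transfer engine) — so the overflow glue cannot be repaired
against the Chow threat by weakening the trace side. [folklore] -/
theorem not_slicePer_of_chowLate
    (hC : ∀ c m₀ : ℕ, ∃ m : ℕ, m₀ ≤ m ∧ ∃ χ : Weight (MatIdx m),
      Module.finrank ℂ (↥(highestWeightSpace (orbitCoordRep (∏ i : Fin m, (X (toLex (i, i)) : MvPolynomial (MatIdx m) ℂ)) m) χ) ⧸ Submodule.comap (highestWeightSpace (orbitCoordRep (∏ i : Fin m, (X (toLex (i, i)) : MvPolynomial (MatIdx m) ℂ)) m) χ).subtype (⨆ p : Weight (MatIdx m) × Weight (MatIdx m), ⨆ (_ : p.1 + p.2 = χ ∧ p.1 ≠ 0 ∧ p.2 ≠ 0), highestWeightSpace (orbitCoordRep (∏ i : Fin m, (X (toLex (i, i)) : MvPolynomial (MatIdx m) ℂ)) m) p.1 * highestWeightSpace (orbitCoordRep (∏ i : Fin m, (X (toLex (i, i)) : MvPolynomial (MatIdx m) ℂ)) m) p.2)) ≠ 0 ∧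
        (m : ℤ) * 2 ^ ((Nat.log 2 m + c) ^ c) < -(Weight.size χ)) :
    ¬ (∀ c : ℕ, ∃ c₀ : ℕ, ∀ m e : ℕ, 1 ≤ m → m + e ≤ 2 ^ ((Nat.log 2 m + c) ^ c) →
      ∀ ι : MatIdx m → MatIdx (m + e), StrictMono ι → IsUpperSet (Set.range ι) →
        ∀ χ : Weight (MatIdx m),
          Module.finrank ℂ (↥(highestWeightSpace (orbitCoordRep (MvPolynomial.rename toLex (perPoly (Fin m) ℂ)) m) χ) ⧸ Submodule.comap (highestWeightSpace (orbitCoordRep (MvPolynomial.rename toLex (perPoly (Fin m) ℂ)) m) χ).subtype (⨆ p : Weight (MatIdx m) × Weight (MatIdx m), ⨆ (_ : p.1 + p.2 = χ ∧ p.1 ≠ 0 ∧ p.2 ≠ 0), highestWeightSpace (orbitCoordRep (MvPolynomial.rename toLex (perPoly (Fin m) ℂ)) m) p.1 * highestWeightSpace (orbitCoordRep (MvPolynomial.rename toLex (perPoly (Fin m) ℂ)) m) p.2)) ≠ 0 →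
          Module.finrank ℂ (↥(highestWeightSpace (orbitCoordRep (powFormLex ℂ (m + e) m) m) (Function.extend ι χ 0)) ⧸ Submodule.comap (highestWeightSpace (orbitCoordRep (powFormLex ℂ (m + e) m) m) (Function.extend ι χ 0)).subtype (⨆ p : Weight (MatIdx (m + e)) × Weight (MatIdx (m + e)), ⨆ (_ : p.1 + p.2 = (Function.extend ι χ 0) ∧ p.1 ≠ 0 ∧ p.2 ≠ 0), highestWeightSpace (orbitCoordRep (powFormLex ℂ (m + e) m) m) p.1 * highestWeightSpace (orbitCoordRep (powFormLex ℂ (m + e) m) m) p.2)) ≠ 0 →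
            -(Weight.size χ) ≤ (m : ℤ) * 2 ^ ((Nat.log 2 m + c₀) ^ c₀)) := by
  intro hS
  obtain ⟨c₀, hc₀⟩ := hS 1
  obtain ⟨m, hm, χ, hγ, hlt⟩ := hC c₀ 1
  have hwin : m + 0 ≤ 2 ^ ((Nat.log 2 m + 1) ^ 1) := by
    rw [pow_one, Nat.add_zero]
    exact (Nat.lt_pow_succ_log_self one_lt_two m).le
  obtain ⟨ι, hι, hup⟩ := exists_finalSegment (n := m) (n' := m + 0) (Nat.le_add_right m 0)
  -- `χ` is a generator type of `A(Δ per_m)` …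
  have hper := finrank_ne_zero_of_mem_orbitClosure (by omega)
    (prod_X_diag_mem_orbitClosure_perPoly m) χ hγ
  -- … and `ext_ι χ` a slice generator type of `A(Δ tr X_m^m)`
  have hmem : rename ι (∏ i : Fin m, (X (toLex (i, i)) : MvPolynomial (MatIdx m) ℂ)) ∈
      orbitClosure (powFormLex ℂ (m + 0) m) := by
    rw [map_prod]
    simp only [rename_X]
    exact prod_X_mem_orbitClosure_powFormLex hm (Nat.le_add_right m 0) _
  have htr := finrank_ne_zero_extend_of_rename_mem_orbitClosure hι hup (prod_X_isHomogeneous _)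
    (prod_X_ne_zero _) (by omega) hmem χ hγ
  exact absurd (hc₀ m 0 hm hwin ι hι hup χ hper htr) (not_le.mpr hlt)

end

end Summit.ValiantsHypothesis.ValiantsHypothesis.Theorems.GeneratorObstructions.SlicePer
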